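import Literature.MathematicalPhysics.KineticTheory.CollisionLineBound
import Literature.MathematicalPhysics.KineticTheory.DiPernaLionsEquicontinuity
import Literature.MathematicalPhysics.KineticTheory.TransportDuhamel
import Literature.Analysis.FunctionSpaces.ParametricIntegralSmooth
import Literature.Analysis.FunctionSpaces.ParametricIntegralDominated
import Literature.Analysis.FunctionSpaces.IteratedFDerivParametricIntegral
import HarnessLib

/-!
# The coefficients of the truncated collision operator for smooth kernels

Topic: MathematicalPhysics / KineticTheory. Infrastructure for the truncated problems of the
DiPerna–Lions scheme (`truncatedProblem_globalExistence`, CIP 1994 Lemma 5.3.6). For a smooth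
kernel `b(z, ω)` on `E × E` (`z = v - v_*` the relative velocity), nonnegative on `E × S^{d-1}`
and vanishing for `|z| ≥ R` (and, for the line bound, near grazing collisions `|⟨z,ω⟩| < δ`), and
a smooth space-time function `f : ℝ × E × E → ℝ`, the building blocks of the truncated operator
`Q̃_δ(f) = (1 + δ∫f dv)⁻¹ (Q⁺(f,f) - f · (A ∗ᵥ f))` are, in the relative variable,
the loss frequency `L f (t,x,v) = ∫ A(z) f(t,x,v-z) dz` (`A = ∫_S b dσ`), the gain
`G f (t,x,v) = ∫_E ∫_S b(z,ω) f(t,x,v-⟨z,ω⟩ω) f(t,x,v-z+⟨z,ω⟩ω) dσ dz`, the mass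
`m f (t,x) = ∫ f(t,x,u) du` and the normalising factor `α = (1 + δ ρ(m f))⁻¹` with a smooth clamp
`ρ`. All objects enter through hypotheses stating their formulas (no definitions). This file
proves their smoothness and the level-zero (sup norm, weighted by `(1 + ‖(x,v)‖)^k`) bounds and
Lipschitz bounds that drive the Picard iteration. Everything is proved; theorems only.

* Kernel: `exists_kernel_bound`, `contDiff_angularIntegral` (`contDiff_parametric_integral` over
  the sphere), `angularIntegral_props`; weights: `one_add_norm_le_of_sub`, `weight_le_of_sub`.
* Loss frequency: `contDiff_lossFrequency`, `lossFrequency_weighted_bound`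
  (`(1+‖(x,v)‖)^k |L f| ≤ (1+R)^k (∫A) C_k`), `lossFrequency_nonneg_le_mass`
  (`0 ≤ L f ≤ M_A ∫ f dv` for `f ≥ 0`), `lossFrequency_sub`.
* Gain: `contDiff_gainAngular`, `contDiff_gain`, `integrable_prod_sphere_of_continuous`,
  `abs_integral_integral_sphere_le`, `gain_weighted_bound`
  (`(1+‖(x,v)‖)^k |G f| ≤ (1+R)^k C_k C_0 ∫∫b`: the weight goes to `f(v')`, `|v - v'| ≤ R`),
  `gain_line_bound` (`|G f| ≤ C_0 · 2M(2R)^{d-1}δ^{1-d} ∫|f| dv`, CIP (3.19), from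
  `lintegral_kernel_gain_line_le`), `gain_weighted_lipschitz`, `gain_nonneg`.
* Mass: `contDiff_mass` (time-localised `contDiff_parametric_integral_of_dominated` under
  Schwartz-type decay in `v`), `mass_nonneg`, `mass_sub_le`, `mass_abs_le`.
* Normalisation: `exists_smooth_normalisation_clamp` (`ρ = id` on `[0,∞)`, `1 + δρ ≥ 3/4`,
  Lipschitz), `contDiff_alpha`, `alpha_bounds` (`0 < α ≤ 4/3`; `α = (1+δm)⁻¹ ≤ 1`, `δ α m ≤ 1`
  for `m ≥ 0`), `alpha_sub_le`.

## References

* C. Cercignani, R. Illner, M. Pulvirenti, *The Mathematical Theory of Dilute Gases*, Springer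
  (1994), §5.3 (3.16)–(3.20) and Lemma 5.3.6, pp. 145–146.
-/

open MeasureTheory Metric Real Set Filter Topology
open scoped InnerProductSpace ENNReal NNReal

noncomputable section

namespace Literature.MathematicalPhysics.KineticTheory


open Literature.Analysis.FluidPDE Literature.Analysis.FunctionSpaces

variable {E : Type*} [NormedAddCommGroup E] [InnerProductSpace ℝ E] [FiniteDimensional ℝ E]
  [MeasurableSpace E] [BorelSpace E]

/-! ## Smooth kernels compactly supported in the relative velocity -/

section Kernel

variable {b : E × E → ℝ}

omit [MeasurableSpace E] [BorelSpace E] in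
/-- A continuous kernel vanishing for `|z| ≥ R` is bounded on `E × S^{d-1}`. [folklore] -/
theorem exists_kernel_bound (hb : Continuous b) {R : ℝ}
    (hbR : ∀ (z : E) (ω : sphere (0 : E) 1), R ≤ ‖z‖ → b (z, ω) = 0) :
    ∃ M : ℝ, 0 ≤ M ∧ ∀ (z : E) (ω : sphere (0 : E) 1), |b (z, ω)| ≤ M := by
  have hK : IsCompact (closedBall (0 : E) R ×ˢ closedBall (0 : E) 1) :=
    (isCompact_closedBall 0 R).prod (isCompact_closedBall 0 1)
  obtain ⟨M, hM⟩ := hK.exists_bound_of_continuousOn hb.continuousOn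
  refine ⟨max M 0, le_max_right _ _, fun z ω => ?_⟩
  by_cases hz : R ≤ ‖z‖
  · rw [hbR z ω hz, abs_zero]; exact le_max_right _ _
  · refine le_trans ?_ (le_max_left _ _)
    have hω : (ω : E) ∈ closedBall (0 : E) 1 := by
      rw [mem_closedBall, dist_zero_right, norm_eq_of_mem_sphere]
    have h := hM (z, (ω : E)) ⟨mem_closedBall_zero_iff.2 (le_of_lt (lt_of_not_ge hz)), hω⟩
    simpa [Real.norm_eq_abs] using h

/-- **The angular integral `A(z) = ∫_{S^{d-1}} b(z, ω) dσ` of a smooth kernel is smooth**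
(differentiation under the integral over the compact sphere, `contDiff_parametric_integral`).
[folklore] -/
theorem contDiff_angularIntegral (hb : ContDiff ℝ ((⊤ : ℕ∞) : WithTop ℕ∞) b) :
    ContDiff ℝ ((⊤ : ℕ∞) : WithTop ℕ∞) fun z : E => ∫ ω, b (z, ω) ∂(sphereMeasure : Measure (sphere (0 : E) 1)) := by
  haveI := isFiniteMeasure_sphereMeasure (E := E)
  have h := contDiff_parametric_integral (μ := (sphereMeasure : Measure (sphere (0 : E) 1)))
    (ι := (Subtype.val : sphere (0 : E) 1 → E)) measurable_subtype_coe (isCompact_sphere (0 : E) 1)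
    (Eventually.of_forall fun ω => ω.2) (G := fun q : E × E => b (q.2, q.1))
    (hb.comp (contDiff_snd.prodMk contDiff_fst))
  exact h

/-- Elementary properties of the angular integral of a nonnegative continuous kernel vanishing
for `|z| ≥ R`: `0 ≤ A ≤ M σ(S^{d-1})`, `A = 0` for `|z| ≥ R`, compact support, integrability.
[folklore] -/
theorem angularIntegral_props (hb : Continuous b) (hb0 : ∀ (z : E) (ω : sphere (0 : E) 1), 0 ≤ b (z, ω))
    {R : ℝ} (hbR : ∀ (z : E) (ω : sphere (0 : E) 1), R ≤ ‖z‖ → b (z, ω) = 0)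
    {M : ℝ} (hM : ∀ (z : E) (ω : sphere (0 : E) 1), |b (z, ω)| ≤ M) :
    (∀ z, 0 ≤ ∫ ω, b (z, ω) ∂(sphereMeasure : Measure (sphere (0 : E) 1))) ∧
    (∀ z, ∫ ω, b (z, ω) ∂(sphereMeasure : Measure (sphere (0 : E) 1)) ≤ M * (sphereMeasure (E := E)).real univ) ∧
    (∀ z : E, R ≤ ‖z‖ → ∫ ω, b (z, ω) ∂(sphereMeasure : Measure (sphere (0 : E) 1)) = 0) ∧
    HasCompactSupport (fun z : E => ∫ ω, b (z, ω) ∂(sphereMeasure : Measure (sphere (0 : E) 1))) ∧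
    Continuous (fun z : E => ∫ ω, b (z, ω) ∂(sphereMeasure : Measure (sphere (0 : E) 1))) := by
  haveI := isFiniteMeasure_sphereMeasure (E := E)
  have hcont : Continuous fun z : E => ∫ ω, b (z, ω) ∂(sphereMeasure : Measure (sphere (0 : E) 1)) := by
    refine continuous_parametric_integral (μ := (sphereMeasure : Measure (sphere (0 : E) 1)))
      (ι := (Subtype.val : sphere (0 : E) 1 → E)) measurable_subtype_coe (isCompact_sphere (0 : E) 1)
      (Eventually.of_forall fun ω => ω.2) (G := fun q : E × E => b (q.2, q.1)) ?_
    exact hb.comp (continuous_snd.prodMk continuous_fst)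
  refine ⟨fun z => integral_nonneg fun ω => hb0 z ω, fun z => ?_, fun z hz => ?_, ?_, hcont⟩
  · calc ∫ ω, b (z, ω) ∂(sphereMeasure : Measure (sphere (0 : E) 1))
        ≤ ∫ _ω, M ∂(sphereMeasure : Measure (sphere (0 : E) 1)) :=
          integral_mono_of_nonneg (Eventually.of_forall fun ω => hb0 z ω) (integrable_const _)
            (Eventually.of_forall fun ω => (le_abs_self _).trans (hM z ω))
      _ = M * (sphereMeasure (E := E)).real univ := by rw [integral_const, smul_eq_mul, mul_comm]
  · simp [hbR z _ hz]
  · refine HasCompactSupport.of_support_subset_isCompact (isCompact_closedBall (0 : E) R) fun z hz => ?_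
    rw [mem_closedBall, dist_zero_right]
    by_contra h
    exact hz (by simp [hbR z _ (le_of_lt (lt_of_not_ge h))])

end Kernel

/-! ## Weight transfer in the velocity variable -/

section Weight

omit [InnerProductSpace ℝ E] [FiniteDimensional ℝ E] [MeasurableSpace E] [BorelSpace E] in
/-- `1 + ‖(x, v)‖ ≤ (1 + R)(1 + ‖(x, v - z)‖)` for `‖z‖ ≤ R`, `R ≥ 0` (max norm). [folklore] -/
theorem one_add_norm_le_of_sub (x v z : E) {R : ℝ} (hR : 0 ≤ R) (hz : ‖z‖ ≤ R) :
    1 + ‖(x, v)‖ ≤ (1 + R) * (1 + ‖(x, v - z)‖) := by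
  have hv : ‖v‖ ≤ ‖v - z‖ + R := by
    calc ‖v‖ = ‖(v - z) + z‖ := by rw [sub_add_cancel]
      _ ≤ ‖v - z‖ + ‖z‖ := norm_add_le _ _
      _ ≤ ‖v - z‖ + R := add_le_add le_rfl hz
  have h1 : ‖(x, v)‖ ≤ ‖(x, v - z)‖ + R := by
    rw [Prod.norm_def, Prod.norm_def]
    refine max_le ?_ ?_
    · exact (le_max_left _ _).trans (le_add_of_nonneg_right hR)
    · exact hv.trans (add_le_add (le_max_right _ _) le_rfl)
  have h0 : 0 ≤ ‖(x, v - z)‖ := norm_nonneg _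
  nlinarith

omit [InnerProductSpace ℝ E] [FiniteDimensional ℝ E] [MeasurableSpace E] [BorelSpace E] in
/-- Weight transfer for the weights `(1 + ‖·‖)^k`. [folklore] -/
theorem weight_le_of_sub (x v z : E) {R : ℝ} (hR : 0 ≤ R) (hz : ‖z‖ ≤ R) (k : ℕ) :
    (1 + ‖(x, v)‖) ^ k ≤ (1 + R) ^ k * (1 + ‖(x, v - z)‖) ^ k := by
  rw [← mul_pow]
  exact pow_le_pow_left₀ (by positivity) (one_add_norm_le_of_sub x v z hR hz) _

end Weight

/-! ## The loss frequency `L f = A ∗ᵥ f` -/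

section Loss

variable {A : E → ℝ} {f g : ℝ × E × E → ℝ} {Lf Lg : ℝ × E × E → ℝ}

/-- Integrals against a continuous `A` vanishing for `|z| ≥ R` are integrals over the ball.
[folklore] -/
theorem integral_eq_setIntegral_closedBall {R : ℝ} (hAR : ∀ z : E, R ≤ ‖z‖ → A z = 0)
    (φ : E → ℝ) : ∫ z, A z * φ z = ∫ z in closedBall (0 : E) R, A z * φ z := by
  refine (setIntegral_eq_integral_of_forall_compl_eq_zero fun z hz => ?_).symm
  rw [mem_closedBall, dist_zero_right, not_le] at hz
  rw [hAR z hz.le, zero_mul]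

/-- **The loss frequency of a smooth function is smooth** (`L f (t,x,v) = ∫ A(z) f(t,x,v-z) dz`,
differentiation under the integral over the ball `|z| ≤ R`). [folklore] -/
theorem contDiff_lossFrequency (hA : ContDiff ℝ ((⊤ : ℕ∞) : WithTop ℕ∞) A) {R : ℝ} (hAR : ∀ z : E, R ≤ ‖z‖ → A z = 0)
    (hf : ContDiff ℝ ((⊤ : ℕ∞) : WithTop ℕ∞) f) (hL : ∀ t x v, Lf (t, x, v) = ∫ z, A z * f (t, x, v - z)) :
    ContDiff ℝ ((⊤ : ℕ∞) : WithTop ℕ∞) Lf := by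
  have hLeq : Lf = fun p : ℝ × E × E => ∫ z, (fun q : E × (ℝ × E × E) => A q.1 * f (q.2.1, q.2.2.1, q.2.2.2 - q.1)) (id z, p)
      ∂((volume : Measure E).restrict (closedBall (0 : E) R)) := by
    funext p
    obtain ⟨t, x, v⟩ := p
    rw [hL, integral_eq_setIntegral_closedBall hAR]
    rfl
  rw [hLeq]
  haveI : IsFiniteMeasure ((volume : Measure E).restrict (closedBall (0 : E) R)) :=
    ⟨by rw [Measure.restrict_apply_univ]; exact measure_closedBall_lt_top⟩
  refine contDiff_parametric_integral (μ := (volume : Measure E).restrict (closedBall (0 : E) R))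
    (ι := (id : E → E)) measurable_id (isCompact_closedBall (0 : E) R) (ae_restrict_mem measurableSet_closedBall)
    (G := fun q : E × (ℝ × E × E) => A q.1 * f (q.2.1, q.2.2.1, q.2.2.2 - q.1)) ?_
  exact (hA.comp contDiff_fst).mul (hf.comp ((contDiff_fst.comp contDiff_snd).prodMk
    ((contDiff_fst.comp (contDiff_snd.comp contDiff_snd)).prodMk
      ((contDiff_snd.comp (contDiff_snd.comp contDiff_snd)).sub contDiff_fst))))

/-- **Weighted bound for the loss frequency**: from `(1+‖(x,u)‖)^k |f(t,x,u)| ≤ C` for all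
`x, u`: `(1+‖(x,v)‖)^k |L f (t,x,v)| ≤ (1+R)^k (∫ A) C` (`A ≥ 0` supported in `|z| ≤ R`).
[folklore] -/
theorem lossFrequency_weighted_bound (hAc : Continuous A) (hA0 : ∀ z, 0 ≤ A z) {R : ℝ} (hR : 0 ≤ R)
    (hAR : ∀ z : E, R ≤ ‖z‖ → A z = 0) (hAcs : HasCompactSupport A) (hfc : Continuous f)
    (hL : ∀ t x v, Lf (t, x, v) = ∫ z, A z * f (t, x, v - z)) (k : ℕ) {t : ℝ} {C : ℝ}
    (hC : ∀ x u : E, (1 + ‖(x, u)‖) ^ k * |f (t, x, u)| ≤ C) (x v : E) :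
    (1 + ‖(x, v)‖) ^ k * |Lf (t, x, v)| ≤ (1 + R) ^ k * (∫ z, A z) * C := by
  have hC0 : 0 ≤ C := le_trans (by positivity) (hC x v)
  have hint : Integrable fun z => A z * f (t, x, v - z) :=
    (hAc.mul (hfc.comp (continuous_const.prodMk (continuous_const.prodMk (continuous_const.sub continuous_id))))).integrable_of_hasCompactSupport
      (hAcs.mul_right)
  rw [hL]
  calc (1 + ‖(x, v)‖) ^ k * |∫ z, A z * f (t, x, v - z)|
      ≤ (1 + ‖(x, v)‖) ^ k * ∫ z, |A z * f (t, x, v - z)| :=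
        mul_le_mul_of_nonneg_left (abs_integral_le_integral_abs) (by positivity)
    _ = ∫ z, (1 + ‖(x, v)‖) ^ k * |A z * f (t, x, v - z)| := (integral_const_mul _ _).symm
    _ ≤ ∫ z, A z * ((1 + R) ^ k * C) := by
        refine integral_mono_of_nonneg (Eventually.of_forall fun z => by positivity)
          ((hAc.mul continuous_const).integrable_of_hasCompactSupport hAcs.mul_right)
          (Eventually.of_forall fun z => ?_)
        show (1 + ‖(x, v)‖) ^ k * |A z * f (t, x, v - z)| ≤ A z * ((1 + R) ^ k * C)
        by_cases hz : R ≤ ‖z‖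
        · simp [hAR z hz]
        · rw [abs_mul, abs_of_nonneg (hA0 z)]
          have hw := weight_le_of_sub x v z hR (le_of_lt (lt_of_not_ge hz)) k
          calc (1 + ‖(x, v)‖) ^ k * (A z * |f (t, x, v - z)|)
              = A z * ((1 + ‖(x, v)‖) ^ k * |f (t, x, v - z)|) := by ring
            _ ≤ A z * ((1 + R) ^ k * (1 + ‖(x, v - z)‖) ^ k * |f (t, x, v - z)|) :=
                mul_le_mul_of_nonneg_left (mul_le_mul_of_nonneg_right hw (abs_nonneg _)) (hA0 z)
            _ ≤ A z * ((1 + R) ^ k * C) := by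
                rw [mul_assoc ((1 + R) ^ k)]
                exact mul_le_mul_of_nonneg_left (mul_le_mul_of_nonneg_left (hC _ _) (by positivity)) (hA0 z)
    _ = (1 + R) ^ k * (∫ z, A z) * C := by rw [integral_mul_const]; ring

/-- **The loss frequency of a nonnegative velocity profile is controlled by its mass**:
`0 ≤ L f (t,x,v) ≤ M_A ∫ f(t,x,u) du` when `f(t,x,·) ≥ 0` is integrable and `0 ≤ A ≤ M_A`.
[folklore] -/
theorem lossFrequency_nonneg_le_mass (hA0 : ∀ z, 0 ≤ A z) {MA : ℝ} (hAM : ∀ z, A z ≤ MA)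
    (hL : ∀ t x v, Lf (t, x, v) = ∫ z, A z * f (t, x, v - z)) {t : ℝ} {x : E}
    (hf0 : ∀ u, 0 ≤ f (t, x, u)) (hfi : Integrable fun u => f (t, x, u)) (v : E) :
    0 ≤ Lf (t, x, v) ∧ Lf (t, x, v) ≤ MA * ∫ u, f (t, x, u) := by
  rw [hL]
  refine ⟨integral_nonneg fun z => mul_nonneg (hA0 z) (hf0 _), ?_⟩
  have hint2 : Integrable fun z => MA * f (t, x, v - z) := (hfi.comp_sub_left v).const_mul MA
  calc ∫ z, A z * f (t, x, v - z) ≤ ∫ z, MA * f (t, x, v - z) := by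
        refine integral_mono_of_nonneg (Eventually.of_forall fun z => mul_nonneg (hA0 z) (hf0 _)) hint2
          (Eventually.of_forall fun z => mul_le_mul_of_nonneg_right (hAM z) (hf0 _))
    _ = MA * ∫ u, f (t, x, u) := by
        rw [integral_const_mul]
        congr 1
        exact integral_sub_left_eq_self (fun u => f (t, x, u)) volume v

/-- **Linearity of the loss frequency in `f`** (difference of two instances). [folklore] -/
theorem lossFrequency_sub (hAc : Continuous A) (hAcs : HasCompactSupport A) (hfc : Continuous f)
    (hgc : Continuous g) (hL : ∀ t x v, Lf (t, x, v) = ∫ z, A z * f (t, x, v - z))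
    (hLg : ∀ t x v, Lg (t, x, v) = ∫ z, A z * g (t, x, v - z)) (t : ℝ) (x v : E) :
    Lf (t, x, v) - Lg (t, x, v) = ∫ z, A z * (f (t, x, v - z) - g (t, x, v - z)) := by
  have hi : ∀ {h : ℝ × E × E → ℝ}, Continuous h → Integrable fun z => A z * h (t, x, v - z) := fun hh =>
    (hAc.mul (hh.comp (continuous_const.prodMk (continuous_const.prodMk (continuous_const.sub continuous_id))))).integrable_of_hasCompactSupport
      hAcs.mul_right
  rw [hL, hLg, ← integral_sub (hi hfc) (hi hgc)]
  refine integral_congr_ae (Eventually.of_forall fun z => ?_)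
  simp only [mul_sub]

end Loss

/-! ## The gain operator in the relative velocity -/

section Gain

variable {b : E × E → ℝ} {f g : ℝ × E × E → ℝ} {Gf Gg : ℝ × E × E → ℝ}

/-- The angular part of the gain integrand, `∫_S b(z,ω) f(v') f(w') dσ`, is smooth in `(z, t, x, v)`
and vanishes for `|z| ≥ R`. [folklore] -/
theorem contDiff_gainAngular (hb : ContDiff ℝ ((⊤ : ℕ∞) : WithTop ℕ∞) b) (hf : ContDiff ℝ ((⊤ : ℕ∞) : WithTop ℕ∞) f) :
    ContDiff ℝ ((⊤ : ℕ∞) : WithTop ℕ∞) fun q : E × (ℝ × E × E) => ∫ ω, b (q.1, ω) *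
      (f (q.2.1, q.2.2.1, q.2.2.2 - ⟪q.1, (ω : E)⟫_ℝ • (ω : E)) *
        f (q.2.1, q.2.2.1, q.2.2.2 - q.1 + ⟪q.1, (ω : E)⟫_ℝ • (ω : E)))
      ∂(sphereMeasure : Measure (sphere (0 : E) 1)) := by
  haveI := isFiniteMeasure_sphereMeasure (E := E)
  refine contDiff_parametric_integral (μ := (sphereMeasure : Measure (sphere (0 : E) 1)))
    (ι := (Subtype.val : sphere (0 : E) 1 → E)) measurable_subtype_coe (isCompact_sphere (0 : E) 1)
    (Eventually.of_forall fun ω => ω.2)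
    (G := fun r : E × (E × (ℝ × E × E)) => b (r.2.1, r.1) *
      (f (r.2.2.1, r.2.2.2.1, r.2.2.2.2 - ⟪r.2.1, r.1⟫_ℝ • r.1) *
        f (r.2.2.1, r.2.2.2.1, r.2.2.2.2 - r.2.1 + ⟪r.2.1, r.1⟫_ℝ • r.1))) ?_
  have hz : ContDiff ℝ ((⊤ : ℕ∞) : WithTop ℕ∞) fun r : E × (E × (ℝ × E × E)) => r.2.1 := contDiff_fst.comp contDiff_snd
  have hy : ContDiff ℝ ((⊤ : ℕ∞) : WithTop ℕ∞) fun r : E × (E × (ℝ × E × E)) => r.1 := contDiff_fst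
  have ht : ContDiff ℝ ((⊤ : ℕ∞) : WithTop ℕ∞) fun r : E × (E × (ℝ × E × E)) => r.2.2.1 := contDiff_fst.comp (contDiff_snd.comp contDiff_snd)
  have hx : ContDiff ℝ ((⊤ : ℕ∞) : WithTop ℕ∞) fun r : E × (E × (ℝ × E × E)) => r.2.2.2.1 :=
    contDiff_fst.comp (contDiff_snd.comp (contDiff_snd.comp contDiff_snd))
  have hv : ContDiff ℝ ((⊤ : ℕ∞) : WithTop ℕ∞) fun r : E × (E × (ℝ × E × E)) => r.2.2.2.2 :=
    contDiff_snd.comp (contDiff_snd.comp (contDiff_snd.comp contDiff_snd))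
  have hs : ContDiff ℝ ((⊤ : ℕ∞) : WithTop ℕ∞) fun r : E × (E × (ℝ × E × E)) => ⟪r.2.1, r.1⟫_ℝ • r.1 := (hz.inner ℝ hy).smul hy
  have h1 : ContDiff ℝ ((⊤ : ℕ∞) : WithTop ℕ∞) fun r : E × (E × (ℝ × E × E)) => b (r.2.1, r.1) := hb.comp (hz.prodMk hy)
  have h2 : ContDiff ℝ ((⊤ : ℕ∞) : WithTop ℕ∞) fun r : E × (E × (ℝ × E × E)) => f (r.2.2.1, r.2.2.2.1, r.2.2.2.2 - ⟪r.2.1, r.1⟫_ℝ • r.1) :=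
    hf.comp (ht.prodMk (hx.prodMk (hv.sub hs)))
  have h3 : ContDiff ℝ ((⊤ : ℕ∞) : WithTop ℕ∞) fun r : E × (E × (ℝ × E × E)) =>
      f (r.2.2.1, r.2.2.2.1, r.2.2.2.2 - r.2.1 + ⟪r.2.1, r.1⟫_ℝ • r.1) :=
    hf.comp (ht.prodMk (hx.prodMk ((hv.sub hz).add hs)))
  exact h1.mul (h2.mul h3)

/-- **The gain term of a smooth function is smooth**
(`G f (t,x,v) = ∫_E ∫_S b(z,ω) f(t,x,v - ⟨z,ω⟩ω) f(t,x,v - z + ⟨z,ω⟩ω) dσ dz`). [folklore] -/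
theorem contDiff_gain (hb : ContDiff ℝ ((⊤ : ℕ∞) : WithTop ℕ∞) b) {R : ℝ}
    (hbR : ∀ (z : E) (ω : sphere (0 : E) 1), R ≤ ‖z‖ → b (z, ω) = 0) (hf : ContDiff ℝ ((⊤ : ℕ∞) : WithTop ℕ∞) f)
    (hG : ∀ t x v, Gf (t, x, v) = ∫ z, ∫ ω, b (z, ω) *
      (f (t, x, v - ⟪z, (ω : E)⟫_ℝ • (ω : E)) * f (t, x, v - z + ⟪z, (ω : E)⟫_ℝ • (ω : E)))
      ∂(sphereMeasure : Measure (sphere (0 : E) 1))) :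
    ContDiff ℝ ((⊤ : ℕ∞) : WithTop ℕ∞) Gf := by
  set I : E × (ℝ × E × E) → ℝ := fun q => ∫ ω, b (q.1, ω) *
      (f (q.2.1, q.2.2.1, q.2.2.2 - ⟪q.1, (ω : E)⟫_ℝ • (ω : E)) *
        f (q.2.1, q.2.2.1, q.2.2.2 - q.1 + ⟪q.1, (ω : E)⟫_ℝ • (ω : E)))
      ∂(sphereMeasure : Measure (sphere (0 : E) 1)) with hI
  have hIs : ContDiff ℝ ((⊤ : ℕ∞) : WithTop ℕ∞) I := contDiff_gainAngular hb hf
  have hI0 : ∀ (z : E) (p : ℝ × E × E), R ≤ ‖z‖ → I (z, p) = 0 := fun z p hz => by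
    simp only [hI, hbR z _ hz, zero_mul, integral_zero]
  have hGeq : Gf = fun p : ℝ × E × E => ∫ z, I (id z, p) ∂((volume : Measure E).restrict (closedBall (0 : E) R)) := by
    funext p
    obtain ⟨t, x, v⟩ := p
    rw [hG]
    refine (setIntegral_eq_integral_of_forall_compl_eq_zero fun z hz => ?_).symm
    rw [mem_closedBall, dist_zero_right, not_le] at hz
    exact hI0 z (t, x, v) hz.le
  rw [hGeq]
  haveI : IsFiniteMeasure ((volume : Measure E).restrict (closedBall (0 : E) R)) :=
    ⟨by rw [Measure.restrict_apply_univ]; exact measure_closedBall_lt_top⟩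
  exact contDiff_parametric_integral (μ := (volume : Measure E).restrict (closedBall (0 : E) R))
    (ι := (id : E → E)) measurable_id (isCompact_closedBall (0 : E) R) (ae_restrict_mem measurableSet_closedBall)
    (G := I) hIs

/-- Integrability on `E × S^{d-1}` of continuous integrands vanishing for `|z| ≥ R`. [folklore] -/
theorem integrable_prod_sphere_of_continuous {Φ : E × sphere (0 : E) 1 → ℝ} (hΦ : Continuous Φ) {R : ℝ}
    (hΦR : ∀ (z : E) (ω : sphere (0 : E) 1), R ≤ ‖z‖ → Φ (z, ω) = 0) :
    Integrable Φ ((volume : Measure E).prod (sphereMeasure : Measure (sphere (0 : E) 1))) := by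
  haveI := isFiniteMeasure_sphereMeasure (E := E)
  refine hΦ.integrable_of_hasCompactSupport ?_
  refine HasCompactSupport.of_support_subset_isCompact ((isCompact_closedBall (0 : E) R).prod isCompact_univ)
    fun q hq => ⟨?_, mem_univ _⟩
  rw [mem_closedBall, dist_zero_right]
  by_contra h
  exact hq (hΦR q.1 q.2 (le_of_lt (lt_of_not_ge h)))

/-- The iterated integral `∫_E ∫_S` of such an integrand is the product integral, and is bounded by
the iterated integral of any pointwise bound `|Φ| ≤ Ψ`. [folklore] -/
theorem abs_integral_integral_sphere_le {Φ Ψ : E × sphere (0 : E) 1 → ℝ} (hΦ : Continuous Φ)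
    (hΨ : Continuous Ψ) {R : ℝ} (hΦR : ∀ (z : E) (ω : sphere (0 : E) 1), R ≤ ‖z‖ → Φ (z, ω) = 0)
    (hΨR : ∀ (z : E) (ω : sphere (0 : E) 1), R ≤ ‖z‖ → Ψ (z, ω) = 0)
    (hle : ∀ z ω, |Φ (z, ω)| ≤ Ψ (z, ω)) :
    |∫ z, ∫ ω, Φ (z, ω) ∂(sphereMeasure : Measure (sphere (0 : E) 1))| ≤
      ∫ z, ∫ ω, Ψ (z, ω) ∂(sphereMeasure : Measure (sphere (0 : E) 1)) := by
  haveI := isFiniteMeasure_sphereMeasure (E := E)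
  have hiΦ := integrable_prod_sphere_of_continuous hΦ hΦR
  have hiΨ := integrable_prod_sphere_of_continuous hΨ hΨR
  rw [← integral_prod _ hiΦ, ← integral_prod _ hiΨ]
  refine (abs_integral_le_integral_abs).trans ?_
  exact integral_mono hiΦ.abs hiΨ (fun q => hle q.1 q.2)

/-- **Weighted bound for the gain term** (the weight goes to the factor `f(v')`,
`|v - v'| = |⟨z,ω⟩| ≤ R`; the factor `f(w')` is bounded by its sup and the kernel integrated):
`(1+‖(x,v)‖)^k |G f (t,x,v)| ≤ (1+R)^k C_k C_0 ∫∫ b`. [folklore] -/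
theorem gain_weighted_bound (hbc : Continuous b) (hb0 : ∀ (z : E) (ω : sphere (0 : E) 1), 0 ≤ b (z, ω))
    {R : ℝ} (hR : 0 ≤ R) (hbR : ∀ (z : E) (ω : sphere (0 : E) 1), R ≤ ‖z‖ → b (z, ω) = 0)
    (hfc : Continuous f)
    (hG : ∀ t x v, Gf (t, x, v) = ∫ z, ∫ ω, b (z, ω) *
      (f (t, x, v - ⟪z, (ω : E)⟫_ℝ • (ω : E)) * f (t, x, v - z + ⟪z, (ω : E)⟫_ℝ • (ω : E)))
      ∂(sphereMeasure : Measure (sphere (0 : E) 1))) (k : ℕ) {t : ℝ} {Ck C0 : ℝ}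
    (hCk : ∀ x u : E, (1 + ‖(x, u)‖) ^ k * |f (t, x, u)| ≤ Ck) (hC0 : ∀ x u : E, |f (t, x, u)| ≤ C0)
    (x v : E) :
    (1 + ‖(x, v)‖) ^ k * |Gf (t, x, v)| ≤
      (1 + R) ^ k * Ck * C0 * ∫ z, ∫ ω, b (z, ω) ∂(sphereMeasure : Measure (sphere (0 : E) 1)) := by
  haveI := isFiniteMeasure_sphereMeasure (E := E)
  have hCk0 : 0 ≤ Ck := le_trans (by positivity) (hCk x v)
  have hC00 : 0 ≤ C0 := (abs_nonneg _).trans (hC0 x v)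
  -- the integrand and its bound
  set Φ : E × sphere (0 : E) 1 → ℝ := fun q => (1 + ‖(x, v)‖) ^ k * (b (q.1, q.2) *
    (f (t, x, v - ⟪q.1, (q.2 : E)⟫_ℝ • (q.2 : E)) * f (t, x, v - q.1 + ⟪q.1, (q.2 : E)⟫_ℝ • (q.2 : E)))) with hΦ
  set Ψ : E × sphere (0 : E) 1 → ℝ := fun q => (1 + R) ^ k * Ck * C0 * b (q.1, q.2) with hΨ
  have hωc : Continuous fun q : E × sphere (0 : E) 1 => ⟪q.1, (q.2 : E)⟫_ℝ • (q.2 : E) :=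
    (continuous_fst.inner (continuous_subtype_val.comp continuous_snd)).smul (continuous_subtype_val.comp continuous_snd)
  have hbq : Continuous fun q : E × sphere (0 : E) 1 => b (q.1, q.2) :=
    hbc.comp (continuous_fst.prodMk (continuous_subtype_val.comp continuous_snd))
  have hΦc : Continuous Φ := by
    refine continuous_const.mul (hbq.mul ((hfc.comp (continuous_const.prodMk (continuous_const.prodMk
      (continuous_const.sub hωc)))).mul (hfc.comp (continuous_const.prodMk (continuous_const.prodMk
        ((continuous_const.sub continuous_fst).add hωc))))))
  have hΨc : Continuous Ψ := continuous_const.mul hbq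
  have hΦR : ∀ (z : E) (ω : sphere (0 : E) 1), R ≤ ‖z‖ → Φ (z, ω) = 0 := fun z ω hz => by
    simp only [hΦ, hbR z ω hz, zero_mul, mul_zero]
  have hΨR : ∀ (z : E) (ω : sphere (0 : E) 1), R ≤ ‖z‖ → Ψ (z, ω) = 0 := fun z ω hz => by
    simp only [hΨ, hbR z ω hz, mul_zero]
  have hle : ∀ z ω, |Φ (z, ω)| ≤ Ψ (z, ω) := by
    intro z ω
    by_cases hz : R ≤ ‖z‖
    · rw [hΦR z ω hz, hΨR z ω hz, abs_zero]
    · have hzR : ‖z‖ ≤ R := le_of_lt (lt_of_not_ge hz)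
      have hsz : ‖⟪z, (ω : E)⟫_ℝ • (ω : E)‖ ≤ R := by
        rw [norm_smul, Real.norm_eq_abs, norm_eq_of_mem_sphere, mul_one]
        exact (abs_real_inner_le_norm _ _).trans (by rw [norm_eq_of_mem_sphere, mul_one]; exact hzR)
      have hw := weight_le_of_sub x v (⟪z, (ω : E)⟫_ℝ • (ω : E)) hR hsz k
      simp only [hΦ, hΨ]
      rw [abs_mul, abs_of_nonneg (by positivity : (0 : ℝ) ≤ (1 + ‖(x, v)‖) ^ k), abs_mul, abs_of_nonneg (hb0 z ω),
        abs_mul]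
      calc (1 + ‖(x, v)‖) ^ k * (b (z, ω) * (|f (t, x, v - ⟪z, (ω : E)⟫_ℝ • (ω : E))| *
            |f (t, x, v - z + ⟪z, (ω : E)⟫_ℝ • (ω : E))|))
          = b (z, ω) * (((1 + ‖(x, v)‖) ^ k * |f (t, x, v - ⟪z, (ω : E)⟫_ℝ • (ω : E))|) *
              |f (t, x, v - z + ⟪z, (ω : E)⟫_ℝ • (ω : E))|) := by ring
        _ ≤ b (z, ω) * (((1 + R) ^ k * Ck) * C0) := by
            refine mul_le_mul_of_nonneg_left (mul_le_mul ?_ (hC0 _ _) (abs_nonneg _) (by positivity)) (hb0 z ω)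
            calc (1 + ‖(x, v)‖) ^ k * |f (t, x, v - ⟪z, (ω : E)⟫_ℝ • (ω : E))|
                ≤ (1 + R) ^ k * (1 + ‖(x, v - ⟪z, (ω : E)⟫_ℝ • (ω : E))‖) ^ k *
                    |f (t, x, v - ⟪z, (ω : E)⟫_ℝ • (ω : E))| :=
                  mul_le_mul_of_nonneg_right hw (abs_nonneg _)
              _ ≤ (1 + R) ^ k * Ck := by
                  rw [mul_assoc]; exact mul_le_mul_of_nonneg_left (hCk _ _) (by positivity)
        _ = (1 + R) ^ k * Ck * C0 * b (z, ω) := by ring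
  have hmain := abs_integral_integral_sphere_le hΦc hΨc hΦR hΨR hle
  -- unfold
  have hL : (1 + ‖(x, v)‖) ^ k * |Gf (t, x, v)| = |∫ z, ∫ ω, Φ (z, ω) ∂(sphereMeasure : Measure (sphere (0 : E) 1))| := by
    rw [hG, ← abs_of_nonneg (by positivity : (0 : ℝ) ≤ (1 + ‖(x, v)‖) ^ k), ← abs_mul, ← integral_const_mul]
    congr 1
    refine integral_congr_ae (Eventually.of_forall fun z => ?_)
    show (1 + ‖(x, v)‖) ^ k * _ = ∫ ω, Φ (z, ω) ∂(sphereMeasure : Measure (sphere (0 : E) 1))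
    rw [← integral_const_mul]
  have hRHS : ∫ z, ∫ ω, Ψ (z, ω) ∂(sphereMeasure : Measure (sphere (0 : E) 1)) =
      (1 + R) ^ k * Ck * C0 * ∫ z, ∫ ω, b (z, ω) ∂(sphereMeasure : Measure (sphere (0 : E) 1)) := by
    simp only [hΨ]
    rw [← integral_const_mul]
    refine integral_congr_ae (Eventually.of_forall fun z => ?_)
    show ∫ ω, (1 + R) ^ k * Ck * C0 * b (z, ω) ∂(sphereMeasure : Measure (sphere (0 : E) 1)) = (1 + R) ^ k * Ck * C0 * _
    rw [← integral_const_mul]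
  rw [hL, ← hRHS]
  exact hmain

/-- **The line bound for the gain term** (CIP 1994 (3.19)): for a kernel `0 ≤ b ≤ M` vanishing
for `|z| ≥ R` and for `|⟨z,ω⟩| < δ`, `|G f (t,x,v)| ≤ C_0 · 2M(2R)^{d-1}δ^{1-d} · ∫ |f(t,x,u)| du`
where `C_0` bounds `|f(t,x,·)|` (`lintegral_kernel_gain_line_le`). This is the linear (in the sup
norm) structure which, with the normalisation `(1 + δ ∫ f)⁻¹`, makes the truncated problem
globally solvable. [cite: CIPDiluteGases1994, §5.3 (3.19) (pp. 145–146)] -/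
theorem gain_line_bound [Nontrivial E] (hbc : Continuous b) (hb0 : ∀ (z : E) (ω : sphere (0 : E) 1), 0 ≤ b (z, ω))
    {M : ℝ} (hbM : ∀ (z : E) (ω : sphere (0 : E) 1), b (z, ω) ≤ M)
    {R : ℝ} (hR : 0 ≤ R) (hbR : ∀ (z : E) (ω : sphere (0 : E) 1), R ≤ ‖z‖ → b (z, ω) = 0)
    {δ : ℝ} (hδ : 0 < δ) (hbδ : ∀ (z : E) (ω : sphere (0 : E) 1), |⟪z, (ω : E)⟫_ℝ| < δ → b (z, ω) = 0)
    (hfc : Continuous f)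
    (hG : ∀ t x v, Gf (t, x, v) = ∫ z, ∫ ω, b (z, ω) *
      (f (t, x, v - ⟪z, (ω : E)⟫_ℝ • (ω : E)) * f (t, x, v - z + ⟪z, (ω : E)⟫_ℝ • (ω : E)))
      ∂(sphereMeasure : Measure (sphere (0 : E) 1))) {t : ℝ} {x : E} {C0 : ℝ}
    (hC0 : ∀ u : E, |f (t, x, u)| ≤ C0) (hfi : Integrable fun u => f (t, x, u)) (v : E) :
    |Gf (t, x, v)| ≤ C0 * (M * (2 * R) ^ (Module.finrank ℝ E - 1) * (2 * (δ ^ (Module.finrank ℝ E - 1))⁻¹)) *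
      ∫ u, |f (t, x, u)| := by
  haveI := isFiniteMeasure_sphereMeasure (E := E)
  have hC00 : 0 ≤ C0 := (abs_nonneg _).trans (hC0 v)
  have hM0 : 0 ≤ M := by
    obtain ⟨ω⟩ : Nonempty (sphere (0 : E) 1) := (NormedSpace.sphere_nonempty.2 zero_le_one).to_subtype
    exact (hb0 0 ω).trans (hbM 0 ω)
  -- Step 1: `|G f| ≤ C0 ∫∫ b |f(v')|`
  set Φ : E × sphere (0 : E) 1 → ℝ := fun q => b (q.1, q.2) *
    (f (t, x, v - ⟪q.1, (q.2 : E)⟫_ℝ • (q.2 : E)) * f (t, x, v - q.1 + ⟪q.1, (q.2 : E)⟫_ℝ • (q.2 : E))) with hΦ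
  set Ψ : E × sphere (0 : E) 1 → ℝ := fun q => C0 * (b (q.1, q.2) * |f (t, x, v - ⟪q.1, (q.2 : E)⟫_ℝ • (q.2 : E))|)
    with hΨ
  have hωc : Continuous fun q : E × sphere (0 : E) 1 => ⟪q.1, (q.2 : E)⟫_ℝ • (q.2 : E) :=
    (continuous_fst.inner (continuous_subtype_val.comp continuous_snd)).smul (continuous_subtype_val.comp continuous_snd)
  have hbq : Continuous fun q : E × sphere (0 : E) 1 => b (q.1, q.2) :=
    hbc.comp (continuous_fst.prodMk (continuous_subtype_val.comp continuous_snd))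
  have hf1 : Continuous fun q : E × sphere (0 : E) 1 => f (t, x, v - ⟪q.1, (q.2 : E)⟫_ℝ • (q.2 : E)) :=
    hfc.comp (continuous_const.prodMk (continuous_const.prodMk (continuous_const.sub hωc)))
  have hΦc : Continuous Φ := hbq.mul (hf1.mul (hfc.comp (continuous_const.prodMk (continuous_const.prodMk
    ((continuous_const.sub continuous_fst).add hωc)))))
  have hΨc : Continuous Ψ := continuous_const.mul (hbq.mul hf1.abs)
  have hΦR : ∀ (z : E) (ω : sphere (0 : E) 1), R ≤ ‖z‖ → Φ (z, ω) = 0 := fun z ω hz => by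
    simp only [hΦ, hbR z ω hz, zero_mul]
  have hΨR : ∀ (z : E) (ω : sphere (0 : E) 1), R ≤ ‖z‖ → Ψ (z, ω) = 0 := fun z ω hz => by
    simp only [hΨ, hbR z ω hz, zero_mul, mul_zero]
  have hle : ∀ z ω, |Φ (z, ω)| ≤ Ψ (z, ω) := fun z ω => by
    simp only [hΦ, hΨ]
    rw [abs_mul, abs_of_nonneg (hb0 z ω), abs_mul]
    calc b (z, ω) * (|f (t, x, v - ⟪z, (ω : E)⟫_ℝ • (ω : E))| * |f (t, x, v - z + ⟪z, (ω : E)⟫_ℝ • (ω : E))|)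
        ≤ b (z, ω) * (|f (t, x, v - ⟪z, (ω : E)⟫_ℝ • (ω : E))| * C0) :=
          mul_le_mul_of_nonneg_left (mul_le_mul_of_nonneg_left (hC0 _) (abs_nonneg _)) (hb0 z ω)
      _ = C0 * (b (z, ω) * |f (t, x, v - ⟪z, (ω : E)⟫_ℝ • (ω : E))|) := by ring
  have h1 : |Gf (t, x, v)| ≤ ∫ z, ∫ ω, Ψ (z, ω) ∂(sphereMeasure : Measure (sphere (0 : E) 1)) := by
    rw [hG]; exact abs_integral_integral_sphere_le hΦc hΨc hΦR hΨR hle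
  -- Step 2: the line bound for `∫∫ b |f(v')|` through lower integrals
  set I : ℝ := ∫ z, ∫ ω, b (z, ω) * |f (t, x, v - ⟪z, (ω : E)⟫_ℝ • (ω : E))| ∂(sphereMeasure : Measure (sphere (0 : E) 1))
    with hI
  have hΨI : ∫ z, ∫ ω, Ψ (z, ω) ∂(sphereMeasure : Measure (sphere (0 : E) 1)) = C0 * I := by
    simp only [hΨ, hI]
    rw [← integral_const_mul]
    refine integral_congr_ae (Eventually.of_forall fun z => ?_)
    show ∫ ω, C0 * _ ∂(sphereMeasure : Measure (sphere (0 : E) 1)) = C0 * _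
    rw [← integral_const_mul]
  set Θ : E × sphere (0 : E) 1 → ℝ := fun q => b (q.1, q.2) * |f (t, x, v - ⟪q.1, (q.2 : E)⟫_ℝ • (q.2 : E))| with hΘ
  have hΘc : Continuous Θ := hbq.mul hf1.abs
  have hΘR : ∀ (z : E) (ω : sphere (0 : E) 1), R ≤ ‖z‖ → Θ (z, ω) = 0 := fun z ω hz => by
    simp only [hΘ, hbR z ω hz, zero_mul]
  have hΘ0 : ∀ q, 0 ≤ Θ q := fun q => mul_nonneg (hb0 _ _) (abs_nonneg _)
  have hΘi := integrable_prod_sphere_of_continuous hΘc hΘR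
  have hIeq : ENNReal.ofReal I = ∫⁻ q, ENNReal.ofReal (Θ q) ∂((volume : Measure E).prod (sphereMeasure : Measure (sphere (0 : E) 1))) := by
    rw [hI, ← integral_prod _ hΘi]
    exact ofReal_integral_eq_lintegral_ofReal hΘi (Eventually.of_forall hΘ0)
  -- the line bound in `∫⁻` form
  have hline := lintegral_kernel_gain_line_le (E := E)
    (b := fun q : E × sphere (0 : E) 1 => ENNReal.ofReal (b (q.1, q.2))) (M := ENNReal.ofReal M)
    ENNReal.ofReal_ne_top (fun q => ENNReal.ofReal_le_ofReal (hbM q.1 q.2)) (R := R) hδ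
    (fun q hq => by simp [hbR q.1 q.2 hq.le]) (fun q hq => by simp [hbδ q.1 q.2 hq])
    (g := fun u => ENNReal.ofReal |f (t, x, u)|)
    ((hfc.comp (continuous_const.prodMk (continuous_const.prodMk continuous_id))).measurable.abs.ennreal_ofReal) v
  have hswap : ∫⁻ q, ENNReal.ofReal (Θ q) ∂((volume : Measure E).prod (sphereMeasure : Measure (sphere (0 : E) 1))) =
      ∫⁻ ω, (∫⁻ z, ENNReal.ofReal (b (z, ω)) * ENNReal.ofReal |f (t, x, v - ⟪z, (ω : E)⟫_ℝ • (ω : E))|)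
        ∂(sphereMeasure : Measure (sphere (0 : E) 1)) := by
    rw [lintegral_prod_symm _ hΘc.measurable.ennreal_ofReal.aemeasurable]
    refine lintegral_congr fun ω => lintegral_congr fun z => ?_
    simp only [hΘ]
    rw [ENNReal.ofReal_mul (hb0 z ω)]
  have hg : ∫⁻ u, ENNReal.ofReal |f (t, x, u)| = ENNReal.ofReal (∫ u, |f (t, x, u)|) :=
    (ofReal_integral_eq_lintegral_ofReal hfi.abs (Eventually.of_forall fun u => abs_nonneg _)).symm
  have hIle : I ≤ (M * (2 * R) ^ (Module.finrank ℝ E - 1) * (2 * (δ ^ (Module.finrank ℝ E - 1))⁻¹)) *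
      ∫ u, |f (t, x, u)| := by
    set n : ℕ := Module.finrank ℝ E - 1 with hn
    have hint0 : 0 ≤ ∫ u, |f (t, x, u)| := integral_nonneg fun u => abs_nonneg _
    have hrhs0 : 0 ≤ (M * (2 * R) ^ n * (2 * (δ ^ n)⁻¹)) * ∫ u, |f (t, x, u)| := by positivity
    rw [← ENNReal.ofReal_le_ofReal_iff hrhs0, hIeq, hswap]
    refine hline.trans (le_of_eq ?_)
    have e1 : ENNReal.ofReal M * ENNReal.ofReal (2 * R) ^ n = ENNReal.ofReal (M * (2 * R) ^ n) := by
      rw [← ENNReal.ofReal_pow (by positivity : (0 : ℝ) ≤ 2 * R), ← ENNReal.ofReal_mul hM0]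
    have e2 : (2 : ℝ≥0∞) * ENNReal.ofReal (δ ^ n)⁻¹ = ENNReal.ofReal (2 * (δ ^ n)⁻¹) := by
      rw [← ENNReal.ofReal_ofNat 2, ← ENNReal.ofReal_mul (by norm_num)]
    rw [hg, e1, e2, ← ENNReal.ofReal_mul (by positivity), ← ENNReal.ofReal_mul (by positivity)]
  calc |Gf (t, x, v)| ≤ C0 * I := h1.trans hΨI.le
    _ ≤ C0 * ((M * (2 * R) ^ (Module.finrank ℝ E - 1) * (2 * (δ ^ (Module.finrank ℝ E - 1))⁻¹)) *
        ∫ u, |f (t, x, u)|) := mul_le_mul_of_nonneg_left hIle hC00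
    _ = _ := by ring

/-- **Weighted Lipschitz bound for the gain term**: with `C_0 ≥ |f|`, `C_k' ≥ (1+‖z‖)^k|g|`,
`D_k ≥ (1+‖z‖)^k|f - g|`, `D_0 ≥ |f - g|` (all at time `t`),
`(1+‖(x,v)‖)^k |G f - G g|(t,x,v) ≤ (1+R)^k (D_k C_0 + C_k' D_0) ∫∫ b`. [folklore] -/
theorem gain_weighted_lipschitz (hbc : Continuous b) (hb0 : ∀ (z : E) (ω : sphere (0 : E) 1), 0 ≤ b (z, ω))
    {R : ℝ} (hR : 0 ≤ R) (hbR : ∀ (z : E) (ω : sphere (0 : E) 1), R ≤ ‖z‖ → b (z, ω) = 0)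
    (hfc : Continuous f) (hgc : Continuous g)
    (hG : ∀ t x v, Gf (t, x, v) = ∫ z, ∫ ω, b (z, ω) *
      (f (t, x, v - ⟪z, (ω : E)⟫_ℝ • (ω : E)) * f (t, x, v - z + ⟪z, (ω : E)⟫_ℝ • (ω : E)))
      ∂(sphereMeasure : Measure (sphere (0 : E) 1)))
    (hGg : ∀ t x v, Gg (t, x, v) = ∫ z, ∫ ω, b (z, ω) *
      (g (t, x, v - ⟪z, (ω : E)⟫_ℝ • (ω : E)) * g (t, x, v - z + ⟪z, (ω : E)⟫_ℝ • (ω : E)))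
      ∂(sphereMeasure : Measure (sphere (0 : E) 1))) (k : ℕ) {t : ℝ} {C0 Ck' Dk D0 : ℝ}
    (hC0 : ∀ x u : E, |f (t, x, u)| ≤ C0) (hCk' : ∀ x u : E, (1 + ‖(x, u)‖) ^ k * |g (t, x, u)| ≤ Ck')
    (hDk : ∀ x u : E, (1 + ‖(x, u)‖) ^ k * |f (t, x, u) - g (t, x, u)| ≤ Dk)
    (hD0 : ∀ x u : E, |f (t, x, u) - g (t, x, u)| ≤ D0) (x v : E) :
    (1 + ‖(x, v)‖) ^ k * |Gf (t, x, v) - Gg (t, x, v)| ≤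
      (1 + R) ^ k * (Dk * C0 + Ck' * D0) * ∫ z, ∫ ω, b (z, ω) ∂(sphereMeasure : Measure (sphere (0 : E) 1)) := by
  haveI := isFiniteMeasure_sphereMeasure (E := E)
  have hC00 : 0 ≤ C0 := (abs_nonneg _).trans (hC0 x v)
  have hCk'0 : 0 ≤ Ck' := le_trans (by positivity) (hCk' x v)
  have hDk0 : 0 ≤ Dk := le_trans (by positivity) (hDk x v)
  have hD00 : 0 ≤ D0 := (abs_nonneg _).trans (hD0 x v)
  -- continuity bookkeeping
  have hωc : Continuous fun q : E × sphere (0 : E) 1 => ⟪q.1, (q.2 : E)⟫_ℝ • (q.2 : E) :=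
    (continuous_fst.inner (continuous_subtype_val.comp continuous_snd)).smul (continuous_subtype_val.comp continuous_snd)
  have hbq : Continuous fun q : E × sphere (0 : E) 1 => b (q.1, q.2) :=
    hbc.comp (continuous_fst.prodMk (continuous_subtype_val.comp continuous_snd))
  have hc1 : ∀ {h : ℝ × E × E → ℝ}, Continuous h →
      Continuous fun q : E × sphere (0 : E) 1 => h (t, x, v - ⟪q.1, (q.2 : E)⟫_ℝ • (q.2 : E)) := fun hh =>
    hh.comp (continuous_const.prodMk (continuous_const.prodMk (continuous_const.sub hωc)))
  have hc2 : ∀ {h : ℝ × E × E → ℝ}, Continuous h →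
      Continuous fun q : E × sphere (0 : E) 1 => h (t, x, v - q.1 + ⟪q.1, (q.2 : E)⟫_ℝ • (q.2 : E)) := fun hh =>
    hh.comp (continuous_const.prodMk (continuous_const.prodMk ((continuous_const.sub continuous_fst).add hωc)))
  -- the product integrands and their difference
  set Pf : E × sphere (0 : E) 1 → ℝ := fun q => b (q.1, q.2) *
    (f (t, x, v - ⟪q.1, (q.2 : E)⟫_ℝ • (q.2 : E)) * f (t, x, v - q.1 + ⟪q.1, (q.2 : E)⟫_ℝ • (q.2 : E))) with hPf
  set Pg : E × sphere (0 : E) 1 → ℝ := fun q => b (q.1, q.2) *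
    (g (t, x, v - ⟪q.1, (q.2 : E)⟫_ℝ • (q.2 : E)) * g (t, x, v - q.1 + ⟪q.1, (q.2 : E)⟫_ℝ • (q.2 : E))) with hPg
  have hPfc : Continuous Pf := hbq.mul ((hc1 hfc).mul (hc2 hfc))
  have hPgc : Continuous Pg := hbq.mul ((hc1 hgc).mul (hc2 hgc))
  have hPfR : ∀ (z : E) (ω : sphere (0 : E) 1), R ≤ ‖z‖ → Pf (z, ω) = 0 := fun z ω hz => by
    simp only [hPf, hbR z ω hz, zero_mul]
  have hPgR : ∀ (z : E) (ω : sphere (0 : E) 1), R ≤ ‖z‖ → Pg (z, ω) = 0 := fun z ω hz => by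
    simp only [hPg, hbR z ω hz, zero_mul]
  -- `G f - G g` as one double integral
  have hdiff : Gf (t, x, v) - Gg (t, x, v) = ∫ z, ∫ ω, (Pf (z, ω) - Pg (z, ω)) ∂(sphereMeasure : Measure (sphere (0 : E) 1)) := by
    have hif := integrable_prod_sphere_of_continuous hPfc hPfR
    have hig := integrable_prod_sphere_of_continuous hPgc hPgR
    rw [hG, hGg]
    change (∫ z, ∫ ω, Pf (z, ω) ∂(sphereMeasure : Measure (sphere (0 : E) 1))) -
      ∫ z, ∫ ω, Pg (z, ω) ∂(sphereMeasure : Measure (sphere (0 : E) 1)) = _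
    rw [← integral_prod _ hif, ← integral_prod _ hig, ← integral_sub hif hig]
    exact integral_prod (fun q : E × sphere (0 : E) 1 => Pf q - Pg q) (hif.sub hig)
  set Φ : E × sphere (0 : E) 1 → ℝ := fun q => (1 + ‖(x, v)‖) ^ k * (Pf q - Pg q) with hΦ
  set Ψ : E × sphere (0 : E) 1 → ℝ := fun q => (1 + R) ^ k * (Dk * C0 + Ck' * D0) * b (q.1, q.2) with hΨ
  have hΦc : Continuous Φ := continuous_const.mul (hPfc.sub hPgc)
  have hΨc : Continuous Ψ := continuous_const.mul hbq
  have hΦR : ∀ (z : E) (ω : sphere (0 : E) 1), R ≤ ‖z‖ → Φ (z, ω) = 0 := fun z ω hz => by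
    simp only [hΦ, hPfR z ω hz, hPgR z ω hz, sub_self, mul_zero]
  have hΨR : ∀ (z : E) (ω : sphere (0 : E) 1), R ≤ ‖z‖ → Ψ (z, ω) = 0 := fun z ω hz => by
    simp only [hΨ, hbR z ω hz, mul_zero]
  have hle : ∀ z ω, |Φ (z, ω)| ≤ Ψ (z, ω) := by
    intro z ω
    by_cases hz : R ≤ ‖z‖
    · rw [hΦR z ω hz, hΨR z ω hz, abs_zero]
    · have hzR : ‖z‖ ≤ R := le_of_lt (lt_of_not_ge hz)
      have hsz : ‖⟪z, (ω : E)⟫_ℝ • (ω : E)‖ ≤ R := by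
        rw [norm_smul, Real.norm_eq_abs, norm_eq_of_mem_sphere, mul_one]
        exact (abs_real_inner_le_norm _ _).trans (by rw [norm_eq_of_mem_sphere, mul_one]; exact hzR)
      have hw := weight_le_of_sub x v (⟪z, (ω : E)⟫_ℝ • (ω : E)) hR hsz k
      set v' : E := v - ⟪z, (ω : E)⟫_ℝ • (ω : E) with hv'
      set w' : E := v - z + ⟪z, (ω : E)⟫_ℝ • (ω : E) with hw'
      -- `f f - g g = (f - g) f + g (f - g)`
      have hsplit : Pf (z, ω) - Pg (z, ω) = b (z, ω) * ((f (t, x, v') - g (t, x, v')) * f (t, x, w') +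
          g (t, x, v') * (f (t, x, w') - g (t, x, w'))) := by
        simp only [hPf, hPg, hv', hw']; ring
      have hterm1 : (1 + ‖(x, v)‖) ^ k * |(f (t, x, v') - g (t, x, v')) * f (t, x, w')| ≤ (1 + R) ^ k * (Dk * C0) := by
        rw [abs_mul]
        calc (1 + ‖(x, v)‖) ^ k * (|f (t, x, v') - g (t, x, v')| * |f (t, x, w')|)
            = ((1 + ‖(x, v)‖) ^ k * |f (t, x, v') - g (t, x, v')|) * |f (t, x, w')| := by ring
          _ ≤ ((1 + R) ^ k * ((1 + ‖(x, v')‖) ^ k * |f (t, x, v') - g (t, x, v')|)) * C0 := by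
              refine mul_le_mul ?_ (hC0 _ _) (abs_nonneg _) (by positivity)
              rw [← mul_assoc]; exact mul_le_mul_of_nonneg_right hw (abs_nonneg _)
          _ ≤ ((1 + R) ^ k * Dk) * C0 := mul_le_mul_of_nonneg_right (mul_le_mul_of_nonneg_left (hDk _ _) (by positivity)) hC00
          _ = (1 + R) ^ k * (Dk * C0) := by ring
      have hterm2 : (1 + ‖(x, v)‖) ^ k * |g (t, x, v') * (f (t, x, w') - g (t, x, w'))| ≤ (1 + R) ^ k * (Ck' * D0) := by
        rw [abs_mul]
        calc (1 + ‖(x, v)‖) ^ k * (|g (t, x, v')| * |f (t, x, w') - g (t, x, w')|)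
            = ((1 + ‖(x, v)‖) ^ k * |g (t, x, v')|) * |f (t, x, w') - g (t, x, w')| := by ring
          _ ≤ ((1 + R) ^ k * ((1 + ‖(x, v')‖) ^ k * |g (t, x, v')|)) * D0 := by
              refine mul_le_mul ?_ (hD0 _ _) (abs_nonneg _) (by positivity)
              rw [← mul_assoc]; exact mul_le_mul_of_nonneg_right hw (abs_nonneg _)
          _ ≤ ((1 + R) ^ k * Ck') * D0 := mul_le_mul_of_nonneg_right (mul_le_mul_of_nonneg_left (hCk' _ _) (by positivity)) hD00
          _ = (1 + R) ^ k * (Ck' * D0) := by ring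
      simp only [hΦ, hΨ]
      rw [hsplit, abs_mul, abs_of_nonneg (by positivity : (0 : ℝ) ≤ (1 + ‖(x, v)‖) ^ k), abs_mul, abs_of_nonneg (hb0 z ω)]
      calc (1 + ‖(x, v)‖) ^ k * (b (z, ω) * |(f (t, x, v') - g (t, x, v')) * f (t, x, w') +
            g (t, x, v') * (f (t, x, w') - g (t, x, w'))|)
          ≤ (1 + ‖(x, v)‖) ^ k * (b (z, ω) * (|(f (t, x, v') - g (t, x, v')) * f (t, x, w')| +
              |g (t, x, v') * (f (t, x, w') - g (t, x, w'))|)) :=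
            mul_le_mul_of_nonneg_left (mul_le_mul_of_nonneg_left (abs_add_le _ _) (hb0 z ω)) (by positivity)
        _ = b (z, ω) * ((1 + ‖(x, v)‖) ^ k * |(f (t, x, v') - g (t, x, v')) * f (t, x, w')| +
              (1 + ‖(x, v)‖) ^ k * |g (t, x, v') * (f (t, x, w') - g (t, x, w'))|) := by ring
        _ ≤ b (z, ω) * ((1 + R) ^ k * (Dk * C0) + (1 + R) ^ k * (Ck' * D0)) :=
            mul_le_mul_of_nonneg_left (add_le_add hterm1 hterm2) (hb0 z ω)
        _ = (1 + R) ^ k * (Dk * C0 + Ck' * D0) * b (z, ω) := by ring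
  have hmain := abs_integral_integral_sphere_le hΦc hΨc hΦR hΨR hle
  have hL : (1 + ‖(x, v)‖) ^ k * |Gf (t, x, v) - Gg (t, x, v)| =
      |∫ z, ∫ ω, Φ (z, ω) ∂(sphereMeasure : Measure (sphere (0 : E) 1))| := by
    rw [hdiff, ← abs_of_nonneg (by positivity : (0 : ℝ) ≤ (1 + ‖(x, v)‖) ^ k), ← abs_mul, ← integral_const_mul]
    congr 1
    refine integral_congr_ae (Eventually.of_forall fun z => ?_)
    show (1 + ‖(x, v)‖) ^ k * _ = ∫ ω, Φ (z, ω) ∂(sphereMeasure : Measure (sphere (0 : E) 1))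
    rw [← integral_const_mul]
  have hRHS : ∫ z, ∫ ω, Ψ (z, ω) ∂(sphereMeasure : Measure (sphere (0 : E) 1)) =
      (1 + R) ^ k * (Dk * C0 + Ck' * D0) * ∫ z, ∫ ω, b (z, ω) ∂(sphereMeasure : Measure (sphere (0 : E) 1)) := by
    simp only [hΨ]
    rw [← integral_const_mul]
    refine integral_congr_ae (Eventually.of_forall fun z => ?_)
    show ∫ ω, (1 + R) ^ k * (Dk * C0 + Ck' * D0) * b (z, ω) ∂(sphereMeasure : Measure (sphere (0 : E) 1)) =
      (1 + R) ^ k * (Dk * C0 + Ck' * D0) * ∫ ω, b (z, ω) ∂(sphereMeasure : Measure (sphere (0 : E) 1))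
    rw [← integral_const_mul]
  rw [hL, ← hRHS]
  exact hmain

/-- **The gain term of a nonnegative profile is nonnegative.** [folklore] -/
theorem gain_nonneg (hb0 : ∀ (z : E) (ω : sphere (0 : E) 1), 0 ≤ b (z, ω))
    (hG : ∀ t x v, Gf (t, x, v) = ∫ z, ∫ ω, b (z, ω) *
      (f (t, x, v - ⟪z, (ω : E)⟫_ℝ • (ω : E)) * f (t, x, v - z + ⟪z, (ω : E)⟫_ℝ • (ω : E)))
      ∂(sphereMeasure : Measure (sphere (0 : E) 1))) {t : ℝ} {x : E} (hf0 : ∀ u, 0 ≤ f (t, x, u)) (v : E) :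
    0 ≤ Gf (t, x, v) := by
  rw [hG]
  exact integral_nonneg fun z => integral_nonneg fun ω => mul_nonneg (hb0 z ω) (mul_nonneg (hf0 _) (hf0 _))

end Gain

/-! ## Velocity moments (the mass density) -/

section Mass

variable {f g : ℝ × E × E → ℝ} {mf mg : ℝ × E → ℝ}

/-- Integrals of measurable functions dominated by a multiple of an integrable weight. [folklore] -/
theorem abs_integral_le_of_dominated {φ w : E → ℝ} (hφm : AEStronglyMeasurable φ) {N : ℝ}
    (hN : ∀ u, |φ u| ≤ N * w u) (hw : Integrable w) :
    Integrable φ ∧ |∫ u, φ u| ≤ N * ∫ u, w u := by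
  have hi : Integrable φ := (hw.const_mul N).mono' hφm (Eventually.of_forall fun u => by
    rw [Real.norm_eq_abs]; exact hN u)
  refine ⟨hi, ?_⟩
  calc |∫ u, φ u| ≤ ∫ u, |φ u| := abs_integral_le_integral_abs
    _ ≤ ∫ u, N * w u := integral_mono hi.abs (hw.const_mul N) hN
    _ = N * ∫ u, w u := integral_const_mul _ _

/-- **Velocity moments of smooth functions with Schwartz-type decay in the velocity are smooth**:
if `‖D^n f (t, x, u)‖ ≤ C_{n,T'} (1 + ‖u‖)^{-r}` (`r > dim E`) locally uniformly in `t` and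
uniformly in `x`, then `m(t,x) = ∫ f(t,x,u) du` is `C^∞` (localisation in time by a bump function
and `contDiff_parametric_integral_of_dominated`). [folklore] -/
theorem contDiff_mass (hf : ContDiff ℝ ((⊤ : ℕ∞) : WithTop ℕ∞) f) {r : ℝ} (hr : (Module.finrank ℝ E : ℝ) < r)
    (hdec : ∀ (n : ℕ) (T' : ℝ), ∃ C : ℝ, ∀ t : ℝ, |t| ≤ T' → ∀ x u : E,
      ‖iteratedFDeriv ℝ n f (t, x, u)‖ ≤ C * (1 + ‖u‖) ^ (-r))
    (hm : ∀ t x, mf (t, x) = ∫ u, f (t, x, u)) : ContDiff ℝ ((⊤ : ℕ∞) : WithTop ℕ∞) mf := by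
  have hw : Integrable fun u : E => (1 + ‖u‖) ^ (-r) := integrable_one_add_norm hr
  refine contDiff_iff_contDiffAt.2 fun p₀ => ?_
  obtain ⟨t₀, x₀⟩ := p₀
  -- a bump in time around `t₀`
  let χ : ContDiffBump t₀ := ⟨1, 2, one_pos, one_lt_two⟩
  have hχs : ContDiff ℝ ((⊤ : ℕ∞) : WithTop ℕ∞) (χ : ℝ → ℝ) := χ.contDiff
  -- the localised integrand on `(ℝ × E) × E`
  set e := LinearIsometryEquiv.prodAssoc ℝ ℝ E E with he
  set G : (ℝ × E) × E → ℝ := fun q => χ q.1.1 * f (q.1.1, q.1.2, q.2) with hGdef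
  have hfe : (fun q : (ℝ × E) × E => f (q.1.1, q.1.2, q.2)) = f ∘ e := by funext q; rfl
  have hL : ContDiff ℝ ((⊤ : ℕ∞) : WithTop ℕ∞) fun q : (ℝ × E) × E => χ q.1.1 := hχs.comp (contDiff_fst.comp contDiff_fst)
  have hfe' : ContDiff ℝ ((⊤ : ℕ∞) : WithTop ℕ∞) fun q : (ℝ × E) × E => f (q.1.1, q.1.2, q.2) := by
    rw [hfe]; exact hf.comp e.contDiff
  have hGs : ContDiff ℝ ((⊤ : ℕ∞) : WithTop ℕ∞) G := hL.mul hfe'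
  -- bounds on the derivatives of the bump factor
  have hχbound : ∀ i : ℕ, ∃ K : ℝ, ∀ q : (ℝ × E) × E, ‖iteratedFDeriv ℝ i (fun q : (ℝ × E) × E => χ q.1.1) q‖ ≤ K := by
    intro i
    set Lf : (ℝ × E) × E →L[ℝ] ℝ := (ContinuousLinearMap.fst ℝ ℝ E).comp (ContinuousLinearMap.fst ℝ (ℝ × E) E) with hLf
    have hcomp : (fun q : (ℝ × E) × E => χ q.1.1) = (χ : ℝ → ℝ) ∘ Lf := by funext q; rfl
    obtain ⟨K, hK⟩ : ∃ K, ∀ s : ℝ, ‖iteratedFDeriv ℝ i (χ : ℝ → ℝ) s‖ ≤ K := by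
      have hc : Continuous (iteratedFDeriv ℝ i (χ : ℝ → ℝ)) := hχs.continuous_iteratedFDeriv (by exact_mod_cast le_top)
      have hcs : HasCompactSupport (iteratedFDeriv ℝ i (χ : ℝ → ℝ)) := χ.hasCompactSupport.iteratedFDeriv i
      obtain ⟨K, hK⟩ := hcs.exists_bound_of_continuous hc
      exact ⟨K, hK⟩
    refine ⟨max K 0 * ‖Lf‖ ^ i, fun q => ?_⟩
    rw [hcomp, Lf.iteratedFDeriv_comp_right hχs q (by exact_mod_cast le_top)]
    refine (ContinuousMultilinearMap.norm_compContinuousLinearMap_le _ _).trans ?_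
    rw [Finset.prod_const, Finset.card_univ, Fintype.card_fin]
    exact mul_le_mul_of_nonneg_right ((hK _).trans (le_max_left _ _)) (by positivity)
  -- the dominated bounds for `G`
  have hGb : ∀ n : ℕ, ∃ bnd : E → ℝ, Integrable bnd ∧ ∀ p u, ‖iteratedFDeriv ℝ n G (p, u)‖ ≤ bnd u := by
    intro n
    choose K hK using hχbound
    choose C hC using fun j : ℕ => hdec j (|t₀| + 2)
    set A : ℝ := ∑ i ∈ Finset.range (n + 1), (n.choose i : ℝ) * (max (K i) 0) * (max (C (n - i)) 0) with hA
    refine ⟨fun u => A * (1 + ‖u‖) ^ (-r), hw.const_mul A, fun p u => ?_⟩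
    by_cases hp : |p.1 - t₀| ≤ 2
    · -- inside the time window: Leibniz
      have ht : |p.1| ≤ |t₀| + 2 := by
        calc |p.1| = |(p.1 - t₀) + t₀| := by rw [sub_add_cancel]
          _ ≤ |p.1 - t₀| + |t₀| := abs_add_le _ _
          _ ≤ |t₀| + 2 := by linarith
      have hleib := norm_iteratedFDeriv_mul_le (n := n) hL hfe' (p, u) (by exact_mod_cast le_top)
      refine hleib.trans ?_
      show _ ≤ A * (1 + ‖u‖) ^ (-r)
      rw [hA, Finset.sum_mul]
      refine Finset.sum_le_sum fun i _ => ?_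
      have h1 : ‖iteratedFDeriv ℝ i (fun q : (ℝ × E) × E => χ q.1.1) (p, u)‖ ≤ max (K i) 0 :=
        (hK i (p, u)).trans (le_max_left _ _)
      have h2 : ‖iteratedFDeriv ℝ (n - i) (fun q : (ℝ × E) × E => f (q.1.1, q.1.2, q.2)) (p, u)‖ ≤
          max (C (n - i)) 0 * (1 + ‖u‖) ^ (-r) := by
        rw [hfe, e.norm_iteratedFDeriv_comp_right]
        exact (hC (n - i) p.1 ht p.2 u).trans (mul_le_mul_of_nonneg_right (le_max_left _ _) (by positivity))
      calc (n.choose i : ℝ) * ‖iteratedFDeriv ℝ i (fun q : (ℝ × E) × E => χ q.1.1) (p, u)‖ *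
            ‖iteratedFDeriv ℝ (n - i) (fun q : (ℝ × E) × E => f (q.1.1, q.1.2, q.2)) (p, u)‖
          ≤ (n.choose i : ℝ) * max (K i) 0 * (max (C (n - i)) 0 * (1 + ‖u‖) ^ (-r)) :=
            mul_le_mul (mul_le_mul_of_nonneg_left h1 (by positivity)) h2 (norm_nonneg _) (by positivity)
        _ = (n.choose i : ℝ) * max (K i) 0 * max (C (n - i)) 0 * (1 + ‖u‖) ^ (-r) := by ring
    · -- outside: `G` vanishes near `(p, u)`
      have hzero : iteratedFDeriv ℝ n G (p, u) = 0 := by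
        refine image_eq_zero_of_notMem_tsupport fun h' => ?_
        have hts := tsupport_iteratedFDeriv_subset n h'
        -- `tsupport G ⊆ {q | q.1.1 ∈ closedBall t₀ 2}`
        have hsub : tsupport G ⊆ {q : (ℝ × E) × E | q.1.1 ∈ closedBall t₀ 2} := by
          refine closure_minimal (fun q hq => ?_) ?_
          · have hχq : χ q.1.1 ≠ 0 := fun h0 => hq (by simp [hGdef, h0])
            have : q.1.1 ∈ Function.support (χ : ℝ → ℝ) := hχq
            rw [χ.support_eq] at this
            exact ball_subset_closedBall this
          · exact isClosed_closedBall.preimage (continuous_fst.comp continuous_fst)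
        have := hsub hts
        simp only [mem_setOf_eq, mem_closedBall, Real.dist_eq] at this
        exact hp this
      rw [hzero, norm_zero]
      have hA0 : 0 ≤ A := Finset.sum_nonneg fun i _ => by positivity
      positivity
  -- the localised moment is smooth and agrees with `m` near `(t₀, x₀)`
  have hsmooth : ContDiff ℝ ((⊤ : ℕ∞) : WithTop ℕ∞) fun p : ℝ × E => ∫ u, G (p, u) := contDiff_parametric_integral_of_dominated hGs hGb
  have heq : (fun p : ℝ × E => ∫ u, G (p, u)) =ᶠ[𝓝 (t₀, x₀)] mf := by
    have hnhds : {p : ℝ × E | p.1 ∈ ball t₀ 1} ∈ 𝓝 (t₀, x₀) :=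
      (isOpen_ball.preimage continuous_fst).mem_nhds (by simp)
    filter_upwards [hnhds] with p hp
    have hχ1 : χ p.1 = 1 := χ.one_of_mem_closedBall (ball_subset_closedBall hp)
    simp only [hGdef, hχ1, one_mul, hm]
  exact (hsmooth.contDiffAt.congr_of_eventuallyEq heq.symm)

/-- The mass of a nonnegative profile is nonnegative. [folklore] -/
theorem mass_nonneg (hm : ∀ t x, mf (t, x) = ∫ u, f (t, x, u)) {t : ℝ} {x : E}
    (hf0 : ∀ u, 0 ≤ f (t, x, u)) : 0 ≤ mf (t, x) := by
  rw [hm]; exact integral_nonneg hf0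

/-- **Lipschitz bound for the mass**: from `|f - g|(t,x,u) ≤ N (1 + ‖u‖)^{-r}` (`r > dim E`)
and integrability of the two velocity profiles, `|m_f - m_g|(t,x) ≤ N ∫ (1+‖u‖)^{-r} du`.
[folklore] -/
theorem mass_sub_le (hm : ∀ t x, mf (t, x) = ∫ u, f (t, x, u)) (hmg : ∀ t x, mg (t, x) = ∫ u, g (t, x, u))
    {r : ℝ} (hr : (Module.finrank ℝ E : ℝ) < r) {t : ℝ} {x : E}
    (hfi : Integrable fun u => f (t, x, u)) (hgi : Integrable fun u => g (t, x, u)) {N : ℝ}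
    (hN : ∀ u, |f (t, x, u) - g (t, x, u)| ≤ N * (1 + ‖u‖) ^ (-r)) :
    |mf (t, x) - mg (t, x)| ≤ N * ∫ u : E, (1 + ‖u‖) ^ (-r) := by
  have hw : Integrable fun u : E => (1 + ‖u‖) ^ (-r) := integrable_one_add_norm hr
  rw [hm, hmg, ← integral_sub hfi hgi]
  exact (abs_integral_le_of_dominated (hfi.sub hgi).aestronglyMeasurable hN hw).2

/-- **Bound for the mass** from `|f|(t,x,u) ≤ N (1 + ‖u‖)^{-r}`: integrability of the profile and
`|m_f(t,x)| ≤ N ∫ (1+‖u‖)^{-r} du`. [folklore] -/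
theorem mass_abs_le (hfc : Continuous f) (hm : ∀ t x, mf (t, x) = ∫ u, f (t, x, u))
    {r : ℝ} (hr : (Module.finrank ℝ E : ℝ) < r) {t : ℝ} {x : E} {N : ℝ}
    (hN : ∀ u, |f (t, x, u)| ≤ N * (1 + ‖u‖) ^ (-r)) :
    Integrable (fun u => f (t, x, u)) ∧ |mf (t, x)| ≤ N * ∫ u : E, (1 + ‖u‖) ^ (-r) := by
  have hw : Integrable fun u : E => (1 + ‖u‖) ^ (-r) := integrable_one_add_norm hr
  have hsl : Continuous fun u => f (t, x, u) := hfc.comp (continuous_const.prodMk (continuous_const.prodMk continuous_id))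
  obtain ⟨hi, hb⟩ := abs_integral_le_of_dominated hsl.aestronglyMeasurable hN hw
  exact ⟨hi, by rw [hm]; exact hb⟩

end Mass

/-! ## The smooth clamp and the normalising factor -/

section Normalisation

/-- **A smooth clamp for the normalisation**: `ρ ∈ C^∞(ℝ)` with `ρ(y) = y` for `y ≥ 0`,
`1 + δρ ≥ 3/4` everywhere, and `ρ` globally Lipschitz. With it `(1 + δ ρ(∫ f dv))⁻¹` is a smooth
function of smooth `f` of any sign and coincides with `(1 + δ ∫ f dv)⁻¹` when `∫ f dv ≥ 0`.
[folklore] -/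
theorem exists_smooth_normalisation_clamp {δ : ℝ} (hδ : 0 < δ) :
    ∃ ρ : ℝ → ℝ, ContDiff ℝ ((⊤ : ℕ∞) : WithTop ℕ∞) ρ ∧ (∀ y, 0 ≤ y → ρ y = y) ∧ (∀ y, 3 / 4 ≤ 1 + δ * ρ y) ∧
      ∃ L : ℝ, 0 ≤ L ∧ ∀ y y', |ρ y - ρ y'| ≤ L * |y - y'| := by
  set c : ℝ := 1 / (4 * δ) with hc
  have hcpos : 0 < c := by positivity
  set ρ : ℝ → ℝ := fun y => (y + c) * Real.smoothTransition ((y + c) / c) - c with hρ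
  have hρs : ContDiff ℝ ((⊤ : ℕ∞) : WithTop ℕ∞) ρ :=
    ((contDiff_id.add contDiff_const).mul (Real.smoothTransition.contDiff.comp
      ((contDiff_id.add contDiff_const).div_const _))).sub contDiff_const
  have hρid : ∀ y, 0 ≤ y → ρ y = y := fun y hy => by
    have h1 : Real.smoothTransition ((y + c) / c) = 1 :=
      Real.smoothTransition.one_of_one_le (by rw [le_div_iff₀ hcpos]; linarith)
    simp only [hρ, h1, mul_one, add_sub_cancel_right]
  have hρlb : ∀ y, -c ≤ ρ y := fun y => by
    simp only [hρ]
    by_cases hy : 0 ≤ y + c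
    · linarith [mul_nonneg hy (Real.smoothTransition.nonneg ((y + c) / c))]
    · have h0 : Real.smoothTransition ((y + c) / c) = 0 :=
        Real.smoothTransition.zero_of_nonpos (div_nonpos_of_nonpos_of_nonneg (le_of_lt (lt_of_not_ge hy)) hcpos.le)
      rw [h0, mul_zero, zero_sub]
  refine ⟨ρ, hρs, hρid, fun y => ?_, ?_⟩
  · have h := hρlb y
    have hδc : δ * c = 1 / 4 := by rw [hc]; field_simp
    nlinarith
  · -- global bound on the derivative: `ρ = id` for `y > 0`, `ρ = -c` for `y < -c`, continuity in between
    have h1 : (((⊤ : ℕ∞) : WithTop ℕ∞)) ≠ 0 := by exact_mod_cast WithTop.coe_ne_zero.2 (by decide)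
    have hdiff : Differentiable ℝ ρ := hρs.differentiable h1
    have hdc : Continuous (deriv ρ) := hρs.continuous_deriv (by exact_mod_cast le_top)
    have hright : ∀ y, 0 < y → deriv ρ y = 1 := fun y hy => by
      have hev : ρ =ᶠ[𝓝 y] id := by
        filter_upwards [Ioi_mem_nhds hy] with y' hy'
        exact hρid y' (le_of_lt hy')
      rw [hev.deriv_eq, deriv_id]
    have hleft : ∀ y, y < -c → deriv ρ y = 0 := fun y hy => by
      have hev : ρ =ᶠ[𝓝 y] fun _ => -c := by
        filter_upwards [Iio_mem_nhds hy] with y' hy'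
        have hy'' : y' < -c := hy'
        have h0 : Real.smoothTransition ((y' + c) / c) = 0 :=
          Real.smoothTransition.zero_of_nonpos (div_nonpos_of_nonpos_of_nonneg (by linarith) hcpos.le)
        simp only [hρ, h0, mul_zero, zero_sub]
      rw [hev.deriv_eq, deriv_const]
    obtain ⟨K, hK⟩ : ∃ K, ∀ y ∈ Icc (-c - 1) 1, |deriv ρ y| ≤ K := by
      obtain ⟨K, hK⟩ := isCompact_Icc.exists_bound_of_continuousOn hdc.continuousOn (s := Icc (-c - 1) (1 : ℝ))
      exact ⟨K, fun y hy => by simpa [Real.norm_eq_abs] using hK y hy⟩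
    set L : ℝ := max K 1 with hL
    have hbound : ∀ y, |deriv ρ y| ≤ L := fun y => by
      rcases lt_or_ge 0 y with hy | hy
      · by_cases hy1 : y ≤ 1
        · exact (hK y ⟨by linarith, hy1⟩).trans (le_max_left _ _)
        · rw [hright y hy, abs_one]; exact le_max_right _ _
      · by_cases hy2 : -c - 1 ≤ y
        · exact (hK y ⟨hy2, by linarith⟩).trans (le_max_left _ _)
        · rw [hleft y (by linarith), abs_zero]; exact le_trans zero_le_one (le_max_right _ _)
    refine ⟨L, le_trans zero_le_one (le_max_right _ _), fun y y' => ?_⟩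
    have h := Convex.norm_image_sub_le_of_norm_deriv_le (f := ρ) (s := univ) (fun x _ => hdiff x)
      (fun x _ => by rw [Real.norm_eq_abs]; exact hbound x) convex_univ (mem_univ y') (mem_univ y)
    simpa [Real.norm_eq_abs] using h

variable {mf mg : ℝ × E → ℝ} {αf αg : ℝ × E → ℝ} {ρ : ℝ → ℝ} {δ : ℝ}

omit [InnerProductSpace ℝ E] [FiniteDimensional ℝ E] [MeasurableSpace E] [BorelSpace E] in
/-- **The normalising factor `α = (1 + δ ρ(m))⁻¹` is smooth** when `m` is. [folklore] -/
theorem contDiff_alpha [NormedSpace ℝ E] (hρ : ContDiff ℝ ((⊤ : ℕ∞) : WithTop ℕ∞) ρ) (hρlb : ∀ y, 3 / 4 ≤ 1 + δ * ρ y)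
    (hm : ContDiff ℝ ((⊤ : ℕ∞) : WithTop ℕ∞) mf) (hα : ∀ p, αf p = (1 + δ * ρ (mf p))⁻¹) : ContDiff ℝ ((⊤ : ℕ∞) : WithTop ℕ∞) αf := by
  have heq : αf = fun p => (1 + δ * ρ (mf p))⁻¹ := funext hα
  rw [heq]
  exact (contDiff_const.add (contDiff_const.mul (hρ.comp hm))).inv fun p => by
    have h := hρlb (mf p)
    simp only [Function.comp_apply]
    linarith

/-- `0 < α ≤ 4/3`; and when `m ≥ 0`: `α = (1 + δ m)⁻¹ ≤ 1` and `δ α m ≤ 1`. [folklore] -/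
theorem alpha_bounds {P : Type*} {mf αf : P → ℝ} (hρid : ∀ y, 0 ≤ y → ρ y = y)
    (hρlb : ∀ y, 3 / 4 ≤ 1 + δ * ρ y) (hδ : 0 < δ)
    (hα : ∀ p, αf p = (1 + δ * ρ (mf p))⁻¹) (p : P) :
    (0 < αf p ∧ αf p ≤ 4 / 3) ∧
      (0 ≤ mf p → αf p = (1 + δ * mf p)⁻¹ ∧ αf p ≤ 1 ∧ δ * αf p * mf p ≤ 1) := by
  have hpos : 0 < 1 + δ * ρ (mf p) := by linarith [hρlb (mf p)]
  refine ⟨⟨by rw [hα]; exact inv_pos.2 hpos, ?_⟩, fun hm => ?_⟩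
  · rw [hα, inv_le_comm₀ hpos (by norm_num)]
    linarith [hρlb (mf p)]
  · have h1 : αf p = (1 + δ * mf p)⁻¹ := by rw [hα, hρid _ hm]
    have hpos' : 0 < 1 + δ * mf p := by positivity
    refine ⟨h1, ?_, ?_⟩
    · rw [h1, inv_le_comm₀ hpos' one_pos, inv_one]
      linarith [mul_nonneg hδ.le hm]
    · rw [h1]
      rw [show δ * (1 + δ * mf p)⁻¹ * mf p = (δ * mf p) / (1 + δ * mf p) by field_simp]
      rw [div_le_one hpos']
      linarith

/-- **Lipschitz bound for the normalising factor**: `|α_f - α_g| ≤ (16/9) δ L |m_f - m_g|`.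
[folklore] -/
theorem alpha_sub_le {P : Type*} {mf mg αf αg : P → ℝ} (hρlb : ∀ y, 3 / 4 ≤ 1 + δ * ρ y) (hδ : 0 < δ)
    {L : ℝ} (hL : 0 ≤ L) (hρL : ∀ y y', |ρ y - ρ y'| ≤ L * |y - y'|)
    (hα : ∀ p, αf p = (1 + δ * ρ (mf p))⁻¹) (hαg : ∀ p, αg p = (1 + δ * ρ (mg p))⁻¹) (p : P) :
    |αf p - αg p| ≤ 16 / 9 * δ * L * |mf p - mg p| := by
  set a : ℝ := 1 + δ * ρ (mf p) with ha
  set a' : ℝ := 1 + δ * ρ (mg p) with ha'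
  have ha34 : 3 / 4 ≤ a := hρlb _
  have ha'34 : 3 / 4 ≤ a' := hρlb _
  rw [hα, hαg]
  change |a⁻¹ - a'⁻¹| ≤ _
  have hsub : a⁻¹ - a'⁻¹ = (a' - a) / (a * a') := by
    field_simp
  rw [hsub, abs_div, abs_of_pos (by positivity : 0 < a * a')]
  have hnum : |a' - a| ≤ δ * L * |mf p - mg p| := by
    have : a' - a = δ * (ρ (mg p) - ρ (mf p)) := by simp only [ha, ha']; ring
    rw [this, abs_mul, abs_of_pos hδ, mul_assoc]
    refine mul_le_mul_of_nonneg_left ?_ hδ.le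
    rw [abs_sub_comm (mf p)]
    exact hρL _ _
  have hden : (9 : ℝ) / 16 ≤ a * a' := by nlinarith
  rw [div_le_iff₀ (by positivity : 0 < a * a')]
  calc |a' - a| ≤ δ * L * |mf p - mg p| := hnum
    _ = δ * L * |mf p - mg p| * 1 := (mul_one _).symm
    _ ≤ δ * L * |mf p - mg p| * (16 / 9 * (a * a')) := by
        refine mul_le_mul_of_nonneg_left ?_ (by positivity)
        nlinarith
    _ = 16 / 9 * δ * L * |mf p - mg p| * (a * a') := by ring

end Normalisation


end Literature.MathematicalPhysics.KineticTheory
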